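import Literature.NumberTheory.Automorphic.WhittakerModelsSupercuspidal
import Literature.NumberTheory.Automorphic.ParabolicInductionSupercuspidalProofs
import HarnessLib

/-!
# Supercuspidal representations of `GL_n(F)` are generic: the discharge

This sibling file of `Literature.NumberTheory.Automorphic.WhittakerModels` discharges the named
fact `Literature.NumberTheory.Automorphic.isGeneric_of_isSupercuspidal π ψ` (Gelfand–Kazhdan 1975,
Thm. 8; Bernstein–Zelevinsky 1977, Theorem 4.4 with §3.5): every irreducible smooth supercuspidal
complex representation `π` of `GL_n(F)`, `F` a non-archimedean local field, admits a non-zero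
Whittaker functional with respect to every non-trivial continuous additive character `ψ`.

It is the meeting point of two results already in the tree:

* `Literature.NumberTheory.Automorphic.isGeneric_of_isSupercuspidal_of_jacquet`
  (`WhittakerModelsSupercuspidal`): the Bernstein–Zelevinsky derivative recursion along the
  column tower of `U_n` proves `isGeneric_of_isSupercuspidal π ψ` *granted* Harish-Chandra's
  criterion `isSupercuspidal_iff_jacquetGL F` (only its forward direction for the maximal
  parabolics `P_{(t,n-t)}` is used: the Jacquet modules of a supercuspidal `π` vanish);
* `Literature.NumberTheory.Automorphic.isSupercuspidal_iff_jacquetGL_holds`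
  (`ParabolicInductionSupercuspidalProofs`): Harish-Chandra's criterion for `GL_n(F)`, proved for
  all smooth `π` (Casselman's mechanism: Iwahori factorisation, contraction of unipotent balls,
  Jacquet's first lemma, with finite averages in place of Haar measure).

Hence `isGeneric_of_isSupercuspidal_holds` below, unconditionally. Theorems only; no `sorry`.

## References

* I. M. Gelfand, D. A. Kazhdan, *Representations of the group `GL(n, K)` where `K` is a local
  field*, in *Lie groups and their representations* (Budapest 1971), Halsted (1975), 95–118,
  Thm. 8 [GelfandKazhdan1975].
* I. N. Bernstein, A. V. Zelevinsky, *Induced representations of reductive `p`-adic groups I*,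
  Ann. Sci. ÉNS (4) 10 (1977), 441–472, §3.5, Theorem 4.4 [BernsteinZelevinskyASENS1977].
* Harish-Chandra, *Harmonic analysis on reductive `p`-adic groups*, LNM 162 (1970), Part I §3
  [HarishChandra1970].
-/

namespace Literature.NumberTheory.Automorphic

universe u

variable {F : Type u} [Field F] [ValuativeRel F] [TopologicalSpace F] [IsNonarchimedeanLocalField F]
  {n : ℕ} {V : Type*} [AddCommGroup V] [Module ℂ V]
  (π : Representation ℂ (GL (Fin n) F) V) (ψ : AddChar F Circle)

/-- **Supercuspidal representations of `GL_n(F)` are generic** (discharge of the named fact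
`isGeneric_of_isSupercuspidal`; Gelfand–Kazhdan 1975, Thm. 8; Bernstein–Zelevinsky 1977,
Theorem 4.4 with §3.5): for an irreducible smooth supercuspidal representation `π` of `GL_n(F)`
and a non-trivial continuous additive character `ψ`, `π` admits a non-zero `ψ`-Whittaker
functional. Proof: the derivative recursion `isGeneric_of_isSupercuspidal_of_jacquet`
(`WhittakerModelsSupercuspidal`), fed with Harish-Chandra's criterion
`isSupercuspidal_iff_jacquetGL_holds` (`ParabolicInductionSupercuspidalProofs`), whose forward
direction kills the Jacquet modules of the maximal parabolics of the supercuspidal `π`.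
[cite: GelfandKazhdan1975, Thm. 8] -/
theorem isGeneric_of_isSupercuspidal_holds : isGeneric_of_isSupercuspidal π ψ :=
  isGeneric_of_isSupercuspidal_of_jacquet π ψ (isSupercuspidal_iff_jacquetGL_holds F)

end Literature.NumberTheory.Automorphic
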